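import Literature.Computability.QuantumComplexity.ForrelationThm25EncodeFP
import Literature.Computability.QuantumComplexity.ForrelationMemValue
import Literature.Computability.Cryptography.ClassBQPReductionProofs
import HarnessLib

/-!
# QSIM over the sign basis is in `PromiseBQP`: reduction to the membership of FORRELATION

Sibling proof file of `QSimSign.lean` (theorems only) towards the discharge of the named fact
`AaronsonAmbainis2018_lemma24_sign_mem` (`qSimSignProblem ∈ PromiseBQP`: AA Lemma 24, membership
half, over the sign basis `{H, Z, CZ, CCZ}`). Source: S. Aaronson, A. Ambainis, *Forrelation*,
SIAM J. Comput. 47 (2018) = arXiv:1411.5729, §6: Lemma 24 ("QSIM is PromiseBQP-complete";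
printed proof of membership: simulate the given circuit, "together with standard
amplification"), Thm. 25 (QSIM Karp-reduces to explicit `k`-fold FORRELATION) and the opening of
§6 ("as we observed in Proposition 6, this problem [explicit `k`-fold FORRELATION] is clearly in
PromiseBQP").

## Proof architecture

In the tree's model (`PromiseBQP` = polynomial-time `TM2`-uniform oracle-free Clifford+`T`
families, wire `0` measured) a direct simulation of `{H, Z, CZ, CCZ}` circuits read off the input
wires is a programmable-layout construction of the size of the phase-query families
(`PhaseQuery*.lean`). Instead the membership is obtained *through* FORRELATION, by three results
of which two are proved in the tree and one is the named fact being discharged in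
`ForrelationMem*.lean`:

1. `AaronsonAmbainis2018_thm25_sign_holds` (`ForrelationThm25EncodeFP.lean`, PROVED): QSIM over
   the sign basis Karp-reduces in polynomial time to `kForrelationProblem` (AA Thm. 25);
2. `Cryptography.mem_PromiseBQP_of_polyTimeReducible` (`ClassBQPReductionProofs.lean`, PROVED):
   `PromiseBQP` is closed downwards under Karp reductions of promise problems (Watrous 2009,
   §IV.1/§IV.3; Goldreich 2006, Def. 3);
3. `AaronsonAmbainis2018_kForrelation_mem` (`ForrelationCompleteProofs.lean`, NAMED FACT):
   `kForrelationProblem ∈ PromiseBQP` (AA §6 p. 26 via Prop. 6).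

Hence `AaronsonAmbainis2018_lemma24_sign_mem_of_kForrelation_mem`; the closed discharge
`AaronsonAmbainis2018_lemma24_sign_mem_holds` is the one-line application to
`AaronsonAmbainis2018_kForrelation_mem_holds` once that lands (append to this file).

## References

* S. Aaronson, A. Ambainis, *Forrelation: a problem that optimally separates quantum from
  classical computing*, SIAM J. Comput. 47 (2018) 982–1038; arXiv:1411.5729, §6 (Lemma 24,
  Thm. 25; held copy `doi:10.1145/2746539.2746547`, pp. 37–38) [AaronsonAmbainis2018].
* J. Watrous, *Quantum computational complexity* (2009), §IV.1, §IV.3 [Watrous2009].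
* O. Goldreich, *On promise problems: a survey*, LNCS 3895 (2006), §1.2 Def. 3 [GoldreichPromise2006].
-/

namespace Literature.Computability.QuantumComplexity

open _root_.Computability Complexity Cryptography

/-- **AA Lemma 24, membership half over the sign basis, from the membership of FORRELATION.**
If explicit `k`-fold FORRELATION is in `PromiseBQP` (`AaronsonAmbainis2018_kForrelation_mem`),
then so is QSIM over `{H, Z, CZ, CCZ}`: it Karp-reduces to FORRELATION by Theorem 25
(`AaronsonAmbainis2018_thm25_sign_holds`) and `PromiseBQP` is closed downwards under Karp
reductions (`mem_PromiseBQP_of_polyTimeReducible`).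
[cite: AaronsonAmbainis2018, §6 Lemma 24 (with Thm. 25 and Prop. 6)] -/
theorem AaronsonAmbainis2018_lemma24_sign_mem_of_kForrelation_mem
    (hmem : AaronsonAmbainis2018_kForrelation_mem) : AaronsonAmbainis2018_lemma24_sign_mem :=
  mem_PromiseBQP_of_polyTimeReducible AaronsonAmbainis2018_thm25_sign_holds hmem

/-- The same from the vendored completeness statement `aaronson_ambainis_kForrelation_complete`
(whose first conjunct is the membership of FORRELATION). [cite: AaronsonAmbainis2018, §6 Lemma 24 (with Thm. 25)] -/
theorem AaronsonAmbainis2018_lemma24_sign_mem_of_complete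
    (h : aaronson_ambainis_kForrelation_complete) : AaronsonAmbainis2018_lemma24_sign_mem :=
  AaronsonAmbainis2018_lemma24_sign_mem_of_kForrelation_mem h.1

/-- **QSIM over the sign basis is `PromiseBQP`-complete, given the two halves of Lemma 24**: with
membership from FORRELATION's (`AaronsonAmbainis2018_kForrelation_mem`) and hardness
(`AaronsonAmbainis2018_lemma24_sign_hard`). [cite: AaronsonAmbainis2018, §6 Lemma 24] -/
theorem qSimSignProblem_complete_of (hmem : AaronsonAmbainis2018_kForrelation_mem)
    (h24 : AaronsonAmbainis2018_lemma24_sign_hard) :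
    qSimSignProblem ∈ PromiseBQP ∧ ∀ Q ∈ PromiseBQP, PromiseProblem.PolyTimeReducible Q qSimSignProblem :=
  ⟨AaronsonAmbainis2018_lemma24_sign_mem_of_kForrelation_mem hmem, h24⟩

/-- Conversely to Theorem 25, **FORRELATION Karp-reduces to QSIM over the sign basis** as soon as
QSIM is `PromiseBQP`-hard (`AaronsonAmbainis2018_lemma24_sign_hard`) and FORRELATION is a member
(`AaronsonAmbainis2018_kForrelation_mem`); then the two problems are inter-reducible and
membership passes between them (`mem_PromiseBQP_iff_of_polyTimeReducible`).
[cite: AaronsonAmbainis2018, §6 (Lemma 24, Thm. 25)] -/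
theorem kForrelationProblem_reducible_qSimSignProblem_of (hmem : AaronsonAmbainis2018_kForrelation_mem)
    (h24 : AaronsonAmbainis2018_lemma24_sign_hard) :
    PromiseProblem.PolyTimeReducible kForrelationProblem qSimSignProblem :=
  h24 _ hmem

/-- DISCHARGE of `AaronsonAmbainis2018_lemma24_sign_mem` (**AA Lemma 24, membership half, over the
sign basis**): QSIM over `{H, Z, CZ, CCZ}` is in `PromiseBQP` — by Theorem 25 it Karp-reduces to
explicit `k`-fold FORRELATION, which is in `PromiseBQP` (`AaronsonAmbainis2018_kForrelation_mem_holds`,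
`ForrelationMemValue.lean`), and `PromiseBQP` is closed downwards under Karp reductions.
[cite: AaronsonAmbainis2018, §6 Lemma 24 (with Thm. 25 and Prop. 6)] -/
theorem AaronsonAmbainis2018_lemma24_sign_mem_holds : AaronsonAmbainis2018_lemma24_sign_mem :=
  AaronsonAmbainis2018_lemma24_sign_mem_of_kForrelation_mem AaronsonAmbainis2018_kForrelation_mem_holds

/-- **QSIM over the sign basis is `PromiseBQP`-complete as soon as it is `PromiseBQP`-hard**
(membership now proved). [cite: AaronsonAmbainis2018, §6 Lemma 24] -/
theorem qSimSignProblem_complete_of_hard (h24 : AaronsonAmbainis2018_lemma24_sign_hard) :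
    qSimSignProblem ∈ PromiseBQP ∧ ∀ Q ∈ PromiseBQP, PromiseProblem.PolyTimeReducible Q qSimSignProblem :=
  qSimSignProblem_complete_of AaronsonAmbainis2018_kForrelation_mem_holds h24

end Literature.Computability.QuantumComplexity
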